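import Literature.Probability.Process.BrownianRunningSup
import Literature.Probability.Process.BrownianSupTail
import HarnessLib

/-!
# The fourth moment of the running supremum of Brownian motion: `E[(sup_{s≤h} |B_s|)⁴] ≤ 18 h²`

Trunk T-PROBABILITY (Literature/Probability/Process); theorems only. For the canonical Brownian
motion (`brownian`, pre-Wiener measure) and its running supremum `runSup h = sup_{s ≤ h} |B_s|`
(`BrownianRunningSup`, an `L²` bound `E[(runSup h)²] ≤ 4h` by Doob's inequality for `B`), we add
the fourth-moment bound

* `lintegral_runSup_pow_four_le` — **`E[(runSup h)⁴] ≤ 18 h²`**: Doob's `L²` maximal inequality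
  (`doob_lintegral_iSup_sq_le_of_continuous`, `DoobL2Inequality`) for the martingale `B_t² − t`
  (`martingale_brownian_sq_sub_holds`) gives `E[sup_{s≤h} (B_s² − s)²] ≤ 4 E[(B_h² − h)²] = 8h²`, and
  pointwise `B_s⁴ ≤ 2 (B_s² − s)² + 2h²` for `s ≤ h`;
* `integrable_runSup_pow_four`, `integral_runSup_pow_four_le` — the real-valued forms.

(Consumed by the small-time part of the finiteness of Brownian loop masses, where the squared
amplitude of a loop times the logarithm of its amplitude must be integrable.)

## References

* D. Revuz, M. Yor, *Continuous Martingales and Brownian Motion* (3rd ed., 1999), Ch. II,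
  Thm (1.7) (Doob's `Lᵖ` inequality). [RevuzYor1999]
-/

noncomputable section

open MeasureTheory ProbabilityTheory Filter Topology Set
open scoped NNReal ENNReal

namespace Literature.Probability.Process

/-- **`E[(runSup h)⁴] ≤ 18 h²`** (extended-real form). [cite: RevuzYor1999, Ch. II Thm (1.7)] -/
theorem lintegral_runSup_pow_four_le (h : ℝ≥0) :
    ∫⁻ ω, ENNReal.ofReal (runSup h ω ^ 4) ∂preWienerMeasure ≤ ENNReal.ofReal (18 * (h : ℝ) ^ 2) := by
  haveI := RandomPlanarGeometry.isProbabilityMeasure_preWienerMeasure'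
  -- Doob for the martingale `M_t = B_t² − t`
  set M : ℝ≥0 → (ℝ≥0 → ℝ) → ℝ := fun t ω ↦ brownian t ω ^ 2 - (t : ℝ) with hM
  have hmart : Martingale M RandomPlanarGeometry.brownianFiltration preWienerMeasure :=
    RandomPlanarGeometry.martingale_brownian_sq_sub_holds
  have hL2 : ∀ s, MemLp (M s) 2 preWienerMeasure := fun s ↦ by
    have h1 := memLp_two_brownian_sub_sq 0 s
    simp only [brownian_zero, sub_zero] at h1
    exact h1.sub (memLp_const _)
  have hcont : ∀ᵐ ω ∂preWienerMeasure, Continuous fun t ↦ M t ω :=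
    Eventually.of_forall fun ω ↦ ((continuous_brownian ω).pow 2).sub NNReal.continuous_coe
  have hD := doob_lintegral_iSup_sq_le_of_continuous hmart hL2 hcont h
  have hMh : ∫⁻ ω, ENNReal.ofReal (M h ω ^ 2) ∂preWienerMeasure = ENNReal.ofReal (2 * (h : ℝ) ^ 2) := by
    have hint : Integrable (fun ω ↦ (brownian h ω ^ 2 - h) ^ 2) preWienerMeasure := by
      have hexp : (fun ω ↦ (brownian h ω ^ 2 - h) ^ 2) =
          fun ω ↦ brownian h ω ^ 4 - 2 * h * brownian h ω ^ 2 + (h : ℝ) ^ 2 := by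
        funext ω; ring
      rw [hexp]
      exact ((integrable_brownian_pow h 4).sub ((integrable_brownian_pow h 2).const_mul _)).add
        (integrable_const _)
    rw [← ofReal_integral_eq_lintegral_ofReal hint (Eventually.of_forall fun ω ↦ sq_nonneg _),
      integral_brownian_sq_sub_sq]
  rw [hMh] at hD
  -- pointwise: `ofReal (runSup⁴) ≤ 2 ⨆_{s ≤ h} ofReal (M_s²) + ofReal (2h²)`
  have hpt : ∀ ω, ENNReal.ofReal (runSup h ω ^ 4) ≤
      2 * (⨆ s ∈ Set.Iic h, ENNReal.ofReal (M s ω ^ 2)) + ENNReal.ofReal (2 * (h : ℝ) ^ 2) := by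
    intro ω
    have hbdd := bddAbove_range_abs_brownian_dyad h ω
    set F : ℝ → ℝ≥0∞ := fun x ↦ ENNReal.ofReal (max x 0 ^ 4) with hF
    have hFmono : Monotone F := fun x y hxy ↦ by
      simp only [hF]
      exact ENNReal.ofReal_le_ofReal (pow_le_pow_left₀ (le_max_right _ _) (max_le_max hxy le_rfl) 4)
    have hFcont : Continuous F := ENNReal.continuous_ofReal.comp ((continuous_id.max continuous_const).pow 4)
    have h1 := Monotone.map_ciSup_of_continuousAt (f := F) hFcont.continuousAt hFmono hbdd
    have hFrun : F (runSup h ω) = ENNReal.ofReal (runSup h ω ^ 4) := by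
      simp only [hF, max_eq_left (runSup_nonneg h ω)]
    rw [← hFrun, runSup, h1]
    refine iSup_le fun p ↦ ?_
    set s := dyadTime h p.1 p.2 with hs
    have hsh : s ≤ h := dyadTime_le h p.1 p.2
    have hrw : F |brownian s ω| = ENNReal.ofReal (brownian s ω ^ 4) := by
      simp only [hF]
      rw [max_eq_left (abs_nonneg (brownian s ω))]
      congr 1
      have := sq_abs (brownian s ω)
      nlinarith [this]
    rw [hrw]
    -- `B_s⁴ ≤ 2 M_s² + 2 h²`
    have hineq : brownian s ω ^ 4 ≤ 2 * M s ω ^ 2 + 2 * (h : ℝ) ^ 2 := by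
      simp only [hM]
      have hs' : (s : ℝ) ≤ h := NNReal.coe_le_coe.2 hsh
      have hs0 : (0 : ℝ) ≤ s := s.coe_nonneg
      nlinarith [sq_nonneg (brownian s ω ^ 2 - s - s), sq_nonneg (brownian s ω)]
    calc ENNReal.ofReal (brownian s ω ^ 4) ≤ ENNReal.ofReal (2 * M s ω ^ 2 + 2 * (h : ℝ) ^ 2) :=
          ENNReal.ofReal_le_ofReal hineq
      _ = 2 * ENNReal.ofReal (M s ω ^ 2) + ENNReal.ofReal (2 * (h : ℝ) ^ 2) := by
          rw [ENNReal.ofReal_add (by positivity) (by positivity), ENNReal.ofReal_mul zero_le_two,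
            ENNReal.ofReal_ofNat]
      _ ≤ 2 * (⨆ s ∈ Set.Iic h, ENNReal.ofReal (M s ω ^ 2)) + ENNReal.ofReal (2 * (h : ℝ) ^ 2) := by
          gcongr
          exact le_iSup₂_of_le (f := fun s (_ : s ∈ Set.Iic h) ↦ ENNReal.ofReal (M s ω ^ 2)) s
            (show s ∈ Set.Iic h from hsh) le_rfl
  -- integrate
  calc ∫⁻ ω, ENNReal.ofReal (runSup h ω ^ 4) ∂preWienerMeasure
      ≤ ∫⁻ ω, (2 * (⨆ s ∈ Set.Iic h, ENNReal.ofReal (M s ω ^ 2)) + ENNReal.ofReal (2 * (h : ℝ) ^ 2)) ∂preWienerMeasure :=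
        lintegral_mono hpt
    _ = 2 * ∫⁻ ω, (⨆ s ∈ Set.Iic h, ENNReal.ofReal (M s ω ^ 2)) ∂preWienerMeasure + ENNReal.ofReal (2 * (h : ℝ) ^ 2) := by
        rw [lintegral_add_right _ measurable_const, lintegral_const_mul' _ _ ENNReal.ofNat_ne_top, lintegral_const,
          measure_univ, mul_one]
    _ ≤ 2 * (4 * ENNReal.ofReal (2 * (h : ℝ) ^ 2)) + ENNReal.ofReal (2 * (h : ℝ) ^ 2) := by
        gcongr
    _ = ENNReal.ofReal (18 * (h : ℝ) ^ 2) := by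
        rw [← ENNReal.ofReal_ofNat 4, ← ENNReal.ofReal_ofNat 2, ← ENNReal.ofReal_mul (by norm_num),
          ← ENNReal.ofReal_mul (by norm_num), ← ENNReal.ofReal_add (by positivity) (by positivity)]
        congr 1
        ring

/-- `(runSup h)⁴` is integrable. [folklore] -/
theorem integrable_runSup_pow_four (h : ℝ≥0) : Integrable (fun ω ↦ runSup h ω ^ 4) preWienerMeasure := by
  haveI := RandomPlanarGeometry.isProbabilityMeasure_preWienerMeasure'
  have hfin : ∫⁻ ω, ENNReal.ofReal (runSup h ω ^ 4) ∂preWienerMeasure ≠ ∞ :=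
    ne_top_of_le_ne_top ENNReal.ofReal_ne_top (lintegral_runSup_pow_four_le h)
  refine ⟨((measurable_runSup h).pow_const 4).aestronglyMeasurable, ?_⟩
  rw [hasFiniteIntegral_iff_ofReal (Eventually.of_forall fun ω ↦ by positivity)]
  exact lt_top_iff_ne_top.2 hfin

/-- **`E[(runSup h)⁴] ≤ 18 h²`** (real form). [cite: RevuzYor1999, Ch. II Thm (1.7)] -/
theorem integral_runSup_pow_four_le (h : ℝ≥0) : ∫ ω, runSup h ω ^ 4 ∂preWienerMeasure ≤ 18 * (h : ℝ) ^ 2 := by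
  rw [integral_eq_lintegral_of_nonneg_ae (Eventually.of_forall fun ω ↦ by positivity)
    ((measurable_runSup h).pow_const 4).aestronglyMeasurable]
  have := ENNReal.toReal_mono ENNReal.ofReal_ne_top (lintegral_runSup_pow_four_le h)
  rwa [ENNReal.toReal_ofReal (by positivity)] at this

end Literature.Probability.Process

end
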